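import Mathlib.Analysis.SpecialFunctions.Pow.Real
import Mathlib.Algebra.Order.Chebyshev
import Mathlib.Algebra.Order.BigOperators.Ring.Finset
import Mathlib.Algebra.Ring.GeomSum
import Mathlib.Data.Finset.Max
import HarnessLib

/-!
# S2β · (SCT-c) K-UNIFORMITY — (★) THE CELL-MAXIMAL SQUARE FUNCTION LEMMA (lattice-free): for nested partitions with classes of size `≤ b^n`, `b ≥ 4`, and `ρ ≥ 0`,
# `Σ_{n ≤ m} max_{c of generation n} S(c)²∕b^n ≤ (2(b−1)∕(b−3))·Σ_x ρ(x)²` — the constant does NOT see the number of generations `m`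

Cell `ym3-torus` (rung R3 = continuum `SU(2)` Yang–Mills on the three-torus — NOT d = 4, NOT infinite volume, NOT a mass gap, NOT Clay).
Width seat «width 21» `ym3-torus-px21` (gen 24); `--kind proof --supports stmt-QuantumFields-20520 --as helper`, count-neutral, DEFINITION-FREE
(0 `def`, 0 `instance`, 0 `notation`, 0 `sorry`, default heartbeats).  Mathlib-only finite-sum algebra; sibling of ✓p829914 (W2) `…WeightedTwoProfileTowerSum`.

WHY (px16 g22 17:49:04Z LOCATE «(SCT-c) K-uniform: true-kernel propagation + the cell-maximal square-function lemma (★)»; px13 g26 17:43:24Z «a K-uniform (SCT-c) needs a norm seeing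
both SUP (smooth) and DILUTION (bump)»; LIFT-LADDER ✓p830137 `supTowerLetter_of_liftLadderLetter`'s hypothesis (SCT-c)).  Propagating the relative curls with the TRUE averaging kernel
(✓`…CoarseCurlOfLinAvg` B2∕C: per step max weight `L^{2−d}`, support = O(1) L-adic cells) turns the `t`-th term of (SCT-c) into `≈ N·Σ_B max_{c ⊂ read(B), gen n} S(c)²∕|c|`
(`S(c)` = the `ℓ¹` mass of the finest relative curls on the cell `c`, `|c| = (L^d)^n`, FLAT weights at `d = 3`); K-uniformity of (SCT-c)'s curl-driven part is then exactly the
statement that the sum over GENERATIONS of the per-generation MAXIMUM of `S(c)²∕|c|` is bounded by the total energy `Σ ρ²` with a constant independent of the number of generations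
— neither the pure-sup route (`×N³` on a one-plaquette bump) nor the per-level energy route (`×log_L N` on smooth data, UV3-NODE §94.5's trap) achieves this; keeping the MAX per
generation and summing the generations does.

THE LEMMA (lattice-free).  Data: a finite type `X`; class maps `cl : ℕ → X → Finset X` with `x ∈ cl n x`, `y ∈ cl n x → cl n y = cl n x` (each `cl n` is a partition), `cl n x ⊆ cl (n+1) x`
(nested ⇒ LAMINAR: two classes are nested or disjoint), `#(cl n x) ≤ b^n` (`b ≥ 4`, a natural number; `b = L^d = 125` in the cell); `ρ : X → ℝ`, `ρ ≥ 0`.  Write `S_j(y) := Σ_{z ∈ cl j y} ρ z`,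
`e_j(y) := S_j(y)²∕b^j`, `E(c) := Σ_{z∈c} ρ z²`, `Q_n(x) := Σ_{j ≤ n} max_{y ∈ cl n x} e_j(y)` (the sum over generations `j ≤ n` of the best gen-`j` class INSIDE `cl n x`).
* §1 laminar algebra (`cl_subset_of_le`, `cl_subset_of_mem`), §2 real helper (`geom_weights_le`: `Σ_{j∈J} b^j ≤ b^{n+1}∕(b−1)` for `J ⊆ {0..n}`).
* §3 ★★★ `cellMax_invariant` — THE STRENGTHENED INVARIANT (px16 g22's road): for every `n` and `x`,
      `Q_n(x) + (2∕(b−3))·e_n(x) ≤ (2(b−1)∕(b−3))·E(cl n x)`.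
  Step `n → n+1` for `c = cl (n+1) x`: pick a gen-`j` maximiser `f_j ⊂ c` for each `j ≤ n`; the ⊂-maximal ones `F` are pairwise DISJOINT with DISTINCT generations (laminar + one per
  generation), so their weights sum to `Σ_F b^{j} ≤ |c|∕(b−1)`; every `f_j` sits inside one `f ∈ F` and contributes to `Q(f)`; `S(c) = S(rest) + Σ_F S(f)`, and two Cauchy–Schwarz steps
  (Chebyshev `sq_sum_le_card_mul_sum_sq` on `rest`, Sedrakyan `sq_sum_div_le_sum_sq_div` on `F`) give `e(c) ≤ 2E(rest) + (2∕(b−1))·Σ_F e(f)`; with the hypothesis on each `f`: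
  `Q(c) + D·e(c) ≤ 2(1+D)·E(rest) + Σ_F [C·E(f) + ((1+D)·2∕(b−1) − D)·e(f)] ≤ C·E(c)` exactly when `D = 2∕(b−3)`, `C = 2(1+D) = 2(b−1)∕(b−3)`.
* §4 ★★★ `cellMax_sum_le` — ONE TOP CLASS (`cl m x₀ = univ`): `Σ_{n ≤ m} max_{y} e_n(y) ≤ (2(b−1)∕(b−3))·Σ_z ρ z²`; ★★ `cellMax_sum_le_of_cover` — several top classes: the same with
  `Σ_{r ∈ R} Q_m(r)` for any family `R` of gen-`m` representatives with pairwise disjoint classes (the read set's cover).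
NUMBERS: `b = 125` ⇒ `C = 248∕122 ≈ 2.033`, `D ≈ 0.0164`; the lemma needs only `b ≥ 4` (`b = 4`: `C = 6`); px16's pure-python worst cases (d = 1 proxy `b = 5`: ≈ 2.3 saturating) sit
inside `C_5 = 4`.

HONEST SCOPE.  Finite-sum combinatorics; the identification of `X`, `cl`, `ρ` with the (0.4) tower's L-adic plaquette cells and finest relative curls, the true-kernel propagation
(max weight `L^{(2−d)n}`, O(1)-cell support) and the θ-suppressed chord→curl sources are the (SCT-c) typist's (px13 g26 ∕ px17 g22), NOT here; nothing of Bałaban's analysis is asserted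
([Balaban1985Averaging] (19)–(20) p.21, Prop. 1: the printed one-step averaging of plaquette variables this bookkeeping serves); (SCT-c), (ST)'s discharge, LOC, D-GUARD, GAP♯∘
(`stub_uniformFibreGapOrbit`, registry untouched, 0∕5), S2β, crux 20520 and `YM3TorusSU2` are NOT proved; no registered stub is closed; rung R3 = SU(2) YM₃ on T³ — NOT d = 4, NOT
infinite volume, NOT a mass gap, NOT Clay; the Yang–Mills mass gap is NOT proved.
References: T. Bałaban, CMP **98** (1985) 17–51 [Balaban1985Averaging]; CMP **109** (1987) 249–301 [Balaban1987RG1].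
-/

set_option autoImplicit false

namespace Summit.QuantumFields.YangMills.Theorems.FluctuationComparisonRegPrIntLS2BetaCellMaximalSquareFunction

open Finset

variable {X : Type*}

/-! ## §1 Laminar algebra of nested class maps -/

/-- Nested classes: `cl j x ⊆ cl j′ x` for `j ≤ j′`. [folklore] -/
theorem cl_subset_of_le (cl : ℕ → X → Finset X) (h_nest : ∀ n x, cl n x ⊆ cl (n + 1) x) {j j' : ℕ} (hjj : j ≤ j') (x : X) :
    cl j x ⊆ cl j' x := by
  induction hjj with
  | refl => exact Subset.rfl
  | step _ ih => exact ih.trans (h_nest _ x)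

/-- **LAMINARITY**: if a gen-`j` class and a gen-`j′` class (`j ≤ j′`) share a point, the first is inside the second. [folklore] -/
theorem cl_subset_of_mem (cl : ℕ → X → Finset X) (h_eq : ∀ n x y, y ∈ cl n x → cl n y = cl n x) (h_nest : ∀ n x, cl n x ⊆ cl (n + 1) x)
    {j j' : ℕ} (hjj : j ≤ j') {x y z : X} (hz : z ∈ cl j x) (hz' : z ∈ cl j' y) : cl j x ⊆ cl j' y := by
  rw [← h_eq j x z hz, ← h_eq j' y z hz']
  exact cl_subset_of_le cl h_nest hjj z

/-- A point of a gen-`j` class lies in the gen-`j′` class of any of its gen-`j′` ancestors' members: `y ∈ cl j′ x`, `j ≤ j′` ⟹ `cl j y ⊆ cl j′ x`. [folklore] -/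
theorem cl_subset_of_mem' (cl : ℕ → X → Finset X) (h_mem : ∀ n x, x ∈ cl n x) (h_eq : ∀ n x y, y ∈ cl n x → cl n y = cl n x)
    (h_nest : ∀ n x, cl n x ⊆ cl (n + 1) x) {j j' : ℕ} (hjj : j ≤ j') {x y : X} (hy : y ∈ cl j' x) : cl j y ⊆ cl j' x :=
  cl_subset_of_mem cl h_eq h_nest hjj (h_mem j y) hy

/-! ## §2 Real helpers -/

/-- Geometric weights on a set of generations `J ⊆ {0, …, n}`: `Σ_{j∈J} b^j ≤ b^{n+1}∕(b−1)` (`b > 1`). [folklore] -/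
theorem geom_weights_le {b : ℝ} (hb : 1 < b) {n : ℕ} {J : Finset ℕ} (hJ : J ⊆ range (n + 1)) :
    ∑ j ∈ J, b ^ j ≤ b ^ (n + 1) / (b - 1) := by
  have hb0 : 0 ≤ b := by linarith
  have h1 : ∑ j ∈ J, b ^ j ≤ ∑ j ∈ range (n + 1), b ^ j := sum_le_sum_of_subset_of_nonneg hJ fun j _ _ => pow_nonneg hb0 j
  have h2 : (∑ j ∈ range (n + 1), b ^ j) * (b - 1) = b ^ (n + 1) - 1 := geom_sum_mul b (n + 1)
  rw [le_div_iff₀ (by linarith)]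
  nlinarith [h1, h2]

/-! ## §3 The strengthened invariant -/

section Invariant

/-- The value `e_k` is constant on a gen-`k` class, so the max over the class of `e_k` is `e_k` at any representative. [folklore] -/
theorem sup'_self_eq (cl : ℕ → X → Finset X) (h_mem : ∀ n x, x ∈ cl n x) (h_eq : ∀ n x y, y ∈ cl n x → cl n y = cl n x)
    (ρ : X → ℝ) (b : ℝ) (k : ℕ) (x : X) :
    (cl k x).sup' ⟨x, h_mem k x⟩ (fun y => (∑ z ∈ cl k y, ρ z) ^ 2 / b ^ k) = (∑ z ∈ cl k x, ρ z) ^ 2 / b ^ k := by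
  refine le_antisymm (sup'_le _ _ fun y hy => ?_) ?_
  · show (∑ z ∈ cl k y, ρ z) ^ 2 / b ^ k ≤ (∑ z ∈ cl k x, ρ z) ^ 2 / b ^ k
    rw [h_eq k x y hy]
  · exact le_sup' (fun y => (∑ z ∈ cl k y, ρ z) ^ 2 / b ^ k) (h_mem k x)

/-- **BASE** (generation `0`, classes of size `≤ 1`): `Q_0(x) + D·e_0(x) = (1+D)·S_0(x)² ≤ (1+D)·E(cl 0 x)` and `1 + D ≤ C`. [folklore] -/
theorem cellMax_base (b : ℕ) (hb : 4 ≤ b) (cl : ℕ → X → Finset X) (h_mem : ∀ n x, x ∈ cl n x) (h_eq : ∀ n x y, y ∈ cl n x → cl n y = cl n x)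
    (h_card : ∀ n x, (cl n x).card ≤ b ^ n) (ρ : X → ℝ) (x : X) :
    (∑ j ∈ range (0 + 1), (cl 0 x).sup' ⟨x, h_mem 0 x⟩ (fun y => (∑ z ∈ cl j y, ρ z) ^ 2 / (b : ℝ) ^ j)) +
        (2 / ((b : ℝ) - 3)) * ((∑ z ∈ cl 0 x, ρ z) ^ 2 / (b : ℝ) ^ 0) ≤
      (2 * ((b : ℝ) - 1) / ((b : ℝ) - 3)) * ∑ z ∈ cl 0 x, ρ z ^ 2 := by
  have hb' : (4 : ℝ) ≤ b := by exact_mod_cast hb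
  rw [zero_add, sum_range_one, sup'_self_eq cl h_mem h_eq ρ (b : ℝ) 0 x, pow_zero, div_one]
  have hcard : ((cl 0 x).card : ℝ) ≤ 1 := by exact_mod_cast (h_card 0 x).trans (pow_zero b).le
  have hE : 0 ≤ ∑ z ∈ cl 0 x, ρ z ^ 2 := sum_nonneg fun z _ => sq_nonneg _
  have hCS : (∑ z ∈ cl 0 x, ρ z) ^ 2 ≤ ∑ z ∈ cl 0 x, ρ z ^ 2 := by
    have h := sq_sum_le_card_mul_sum_sq (s := cl 0 x) (f := ρ)
    exact h.trans (mul_le_of_le_one_left hE hcard)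
  have hD : 0 ≤ 2 / ((b : ℝ) - 3) := by apply div_nonneg <;> linarith
  -- (1 + D)·S² ≤ (1 + D)·E ≤ C·E, with C = 2(1 + D)
  have hpos : 0 < (b : ℝ) - 3 := by linarith
  have hC : 1 + 2 / ((b : ℝ) - 3) ≤ 2 * ((b : ℝ) - 1) / ((b : ℝ) - 3) := by
    have e1 : 1 + 2 / ((b : ℝ) - 3) = ((b : ℝ) - 1) / ((b : ℝ) - 3) := by field_simp; ring
    rw [e1, div_le_div_iff_of_pos_right hpos]; linarith
  nlinarith [hCS, hD, hC, hE]


/-- **STEP** (generation `n → n+1`): the laminar-family argument — maximisers per generation, their ⊂-maximal members (pairwise disjoint, distinct generations, total weight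
`≤ b^{n+1}∕(b−1)`), Chebyshev on the rest, Sedrakyan on the maximal members, the hypothesis on each of them. [folklore] -/
theorem cellMax_step [DecidableEq X] (b : ℕ) (hb : 4 ≤ b) (cl : ℕ → X → Finset X) (h_mem : ∀ n x, x ∈ cl n x)
    (h_eq : ∀ n x y, y ∈ cl n x → cl n y = cl n x) (h_nest : ∀ n x, cl n x ⊆ cl (n + 1) x) (h_card : ∀ n x, (cl n x).card ≤ b ^ n)
    (ρ : X → ℝ) (n : ℕ)
    (ih : ∀ k, k ≤ n → ∀ y : X,
      (∑ j ∈ range (k + 1), (cl k y).sup' ⟨y, h_mem k y⟩ (fun y' => (∑ z ∈ cl j y', ρ z) ^ 2 / (b : ℝ) ^ j)) +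
          (2 / ((b : ℝ) - 3)) * ((∑ z ∈ cl k y, ρ z) ^ 2 / (b : ℝ) ^ k) ≤
        (2 * ((b : ℝ) - 1) / ((b : ℝ) - 3)) * ∑ z ∈ cl k y, ρ z ^ 2)
    (x : X) :
    (∑ j ∈ range (n + 1 + 1), (cl (n + 1) x).sup' ⟨x, h_mem (n + 1) x⟩ (fun y' => (∑ z ∈ cl j y', ρ z) ^ 2 / (b : ℝ) ^ j)) +
        (2 / ((b : ℝ) - 3)) * ((∑ z ∈ cl (n + 1) x, ρ z) ^ 2 / (b : ℝ) ^ (n + 1)) ≤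
      (2 * ((b : ℝ) - 1) / ((b : ℝ) - 3)) * ∑ z ∈ cl (n + 1) x, ρ z ^ 2 := by
  have hb' : (4 : ℝ) ≤ b := by exact_mod_cast hb
  have hbR0 : 0 < (b : ℝ) := by linarith
  have hbR1 : 1 < (b : ℝ) := by linarith
  have hne3 : (b : ℝ) - 3 ≠ 0 := by intro h; linarith
  have hne1 : (b : ℝ) - 1 ≠ 0 := by intro h; linarith
  set C : ℝ := 2 * ((b : ℝ) - 1) / ((b : ℝ) - 3) with hC
  set D : ℝ := 2 / ((b : ℝ) - 3) with hD
  have hD0 : 0 ≤ D := by rw [hD]; apply div_nonneg <;> linarith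
  have hC0 : 0 ≤ C := by rw [hC]; apply div_nonneg <;> nlinarith
  have hconst1 : (1 + D) * (2 / ((b : ℝ) - 1)) = D := by rw [hD]; field_simp; ring
  have hconst2 : 2 * (1 + D) = C := by rw [hD, hC]; field_simp; ring
  -- nonnegativity of the `e`-values
  have he0 : ∀ j y, 0 ≤ (∑ z ∈ cl j y, ρ z) ^ 2 / (b : ℝ) ^ j := fun j y => by positivity
  have hxc : x ∈ cl (n + 1) x := h_mem (n + 1) x
  -- (1) maximisers per generation inside `c = cl (n+1) x`
  have hmax : ∀ j, ∃ y ∈ cl (n + 1) x, ∀ y' ∈ cl (n + 1) x,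
      (∑ z ∈ cl j y', ρ z) ^ 2 / (b : ℝ) ^ j ≤ (∑ z ∈ cl j y, ρ z) ^ 2 / (b : ℝ) ^ j := fun j =>
    exists_max_image (cl (n + 1) x) (fun y => (∑ z ∈ cl j y, ρ z) ^ 2 / (b : ℝ) ^ j) ⟨x, hxc⟩
  choose Y hYc hYmax using hmax
  have hsup : ∀ j, (cl (n + 1) x).sup' ⟨x, hxc⟩ (fun y' => (∑ z ∈ cl j y', ρ z) ^ 2 / (b : ℝ) ^ j) =
      (∑ z ∈ cl j (Y j), ρ z) ^ 2 / (b : ℝ) ^ j := fun j =>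
    le_antisymm (sup'_le _ _ fun y' hy' => hYmax j y' hy') (le_sup' (fun y' => (∑ z ∈ cl j y', ρ z) ^ 2 / (b : ℝ) ^ j) (hYc j))
  have hfc : ∀ j, j ≤ n + 1 → cl j (Y j) ⊆ cl (n + 1) x := fun j hj => cl_subset_of_mem' cl h_mem h_eq h_nest hj (hYc j)
  -- (2) the parent map `p` (the largest later maximiser containing `f_j`) and the ⊂-maximal family `J = p(range (n+1))`
  set p : ℕ → ℕ := fun j => ((range (n + 1)).filter (fun j' => j ≤ j' ∧ cl j (Y j) ⊆ cl j' (Y j'))).sup id with hp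
  have hp_spec : ∀ j, j ∈ range (n + 1) → p j ∈ range (n + 1) ∧ j ≤ p j ∧ cl j (Y j) ⊆ cl (p j) (Y (p j)) ∧
      ∀ j', j' ∈ range (n + 1) → j ≤ j' → cl j (Y j) ⊆ cl j' (Y j') → j' ≤ p j := by
    intro j hj
    have hjT : j ∈ (range (n + 1)).filter (fun j' => j ≤ j' ∧ cl j (Y j) ⊆ cl j' (Y j')) := by
      rw [mem_filter]; exact ⟨hj, le_rfl, Subset.rfl⟩
    obtain ⟨i, hiT, hi⟩ := exists_mem_eq_sup _ ⟨j, hjT⟩ id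
    have hpj : p j = i := hi
    rw [mem_filter] at hiT
    refine ⟨hpj ▸ hiT.1, hpj ▸ hiT.2.1, hpj ▸ hiT.2.2, fun j' hj' hjj' hsub => ?_⟩
    have hj'T : j' ∈ (range (n + 1)).filter (fun j' => j ≤ j' ∧ cl j (Y j) ⊆ cl j' (Y j')) := by
      rw [mem_filter]; exact ⟨hj', hjj', hsub⟩
    exact le_sup (f := id) hj'T
  set J : Finset ℕ := (range (n + 1)).image p with hJ
  have hpJ : ∀ j, j ∈ range (n + 1) → p j ∈ J := fun j hj => mem_image_of_mem p hj
  have hJsub : J ⊆ range (n + 1) := by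
    intro j' hj'
    obtain ⟨j, hj, rfl⟩ := mem_image.mp hj'
    exact (hp_spec j hj).1
  -- (3) disjointness of the classes indexed by `J`
  have hdisj : (J : Set ℕ).PairwiseDisjoint (fun j => cl j (Y j)) := by
    intro a ha c hc hne
    obtain ⟨j₁, hj₁, rfl⟩ := mem_image.mp (mem_coe.mp ha)
    obtain ⟨j₂, hj₂, rfl⟩ := mem_image.mp (mem_coe.mp hc)
    rw [Function.onFun, disjoint_left]
    intro z hz₁ hz₂
    obtain ⟨hp₁r, hj₁p, hsub₁, hmax₁⟩ := hp_spec j₁ hj₁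
    obtain ⟨hp₂r, hj₂p, hsub₂, hmax₂⟩ := hp_spec j₂ hj₂
    rcases lt_or_gt_of_ne hne with h | h
    · have hcl := cl_subset_of_mem cl h_eq h_nest h.le hz₁ hz₂
      have := hmax₁ (p j₂) hp₂r (hj₁p.trans h.le) (hsub₁.trans hcl)
      omega
    · have hcl := cl_subset_of_mem cl h_eq h_nest h.le hz₂ hz₁
      have := hmax₂ (p j₁) hp₁r (hj₂p.trans h.le) (hsub₂.trans hcl)
      omega
  -- (4) the decomposition `c = rest ⊔ ⋃_J f`
  set U : Finset X := J.biUnion (fun j => cl j (Y j)) with hU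
  have hUc : U ⊆ cl (n + 1) x := by
    rw [hU]; refine biUnion_subset.mpr fun j hj => hfc j ?_
    have := mem_range.mp (hJsub hj); omega
  have hS : ∑ z ∈ cl (n + 1) x, ρ z = ∑ z ∈ cl (n + 1) x \ U, ρ z + ∑ j ∈ J, ∑ z ∈ cl j (Y j), ρ z := by
    rw [← sum_biUnion hdisj, sum_sdiff hUc]
  have hEsum : ∑ z ∈ cl (n + 1) x, ρ z ^ 2 = ∑ z ∈ cl (n + 1) x \ U, ρ z ^ 2 + ∑ j ∈ J, ∑ z ∈ cl j (Y j), ρ z ^ 2 := by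
    rw [← sum_biUnion hdisj, sum_sdiff hUc]
  -- (5) Chebyshev on the rest
  have hErest0 : 0 ≤ ∑ z ∈ cl (n + 1) x \ U, ρ z ^ 2 := sum_nonneg fun z _ => sq_nonneg _
  have hrest : (∑ z ∈ cl (n + 1) x \ U, ρ z) ^ 2 ≤ (b : ℝ) ^ (n + 1) * ∑ z ∈ cl (n + 1) x \ U, ρ z ^ 2 := by
    have h1 := sq_sum_le_card_mul_sum_sq (s := cl (n + 1) x \ U) (f := ρ)
    have h2 : ((cl (n + 1) x \ U).card : ℝ) ≤ (b : ℝ) ^ (n + 1) := by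
      have := (card_le_card (sdiff_subset (s := cl (n + 1) x) (t := U))).trans (h_card (n + 1) x)
      exact_mod_cast this
    exact h1.trans (mul_le_mul_of_nonneg_right h2 hErest0)
  -- (6) Sedrakyan on the maximal family
  have hsumF0 : 0 ≤ ∑ j ∈ J, (∑ z ∈ cl j (Y j), ρ z) ^ 2 / (b : ℝ) ^ j := sum_nonneg fun j _ => he0 j _
  have hsed : (∑ j ∈ J, ∑ z ∈ cl j (Y j), ρ z) ^ 2 ≤
      ((b : ℝ) ^ (n + 1) / ((b : ℝ) - 1)) * ∑ j ∈ J, (∑ z ∈ cl j (Y j), ρ z) ^ 2 / (b : ℝ) ^ j := by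
    have hw : ∑ j ∈ J, (b : ℝ) ^ j ≤ (b : ℝ) ^ (n + 1) / ((b : ℝ) - 1) := geom_weights_le hbR1 hJsub
    rcases J.eq_empty_or_nonempty with hJe | hJne
    · rw [hJe]; simp
    · have hg : ∀ j ∈ J, 0 < (b : ℝ) ^ j := fun j _ => pow_pos hbR0 j
      have hgsum : 0 < ∑ j ∈ J, (b : ℝ) ^ j := sum_pos hg hJne
      have h := sq_sum_div_le_sum_sq_div J (fun j => ∑ z ∈ cl j (Y j), ρ z) hg
      rw [div_le_iff₀ hgsum] at h
      calc (∑ j ∈ J, ∑ z ∈ cl j (Y j), ρ z) ^ 2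
          ≤ (∑ j ∈ J, (∑ z ∈ cl j (Y j), ρ z) ^ 2 / (b : ℝ) ^ j) * ∑ j ∈ J, (b : ℝ) ^ j := h
        _ = (∑ j ∈ J, (b : ℝ) ^ j) * ∑ j ∈ J, (∑ z ∈ cl j (Y j), ρ z) ^ 2 / (b : ℝ) ^ j := by rw [mul_comm]
        _ ≤ ((b : ℝ) ^ (n + 1) / ((b : ℝ) - 1)) * ∑ j ∈ J, (∑ z ∈ cl j (Y j), ρ z) ^ 2 / (b : ℝ) ^ j :=
            mul_le_mul_of_nonneg_right hw hsumF0
  -- (7) the `e(c)` bound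
  have hec : (∑ z ∈ cl (n + 1) x, ρ z) ^ 2 / (b : ℝ) ^ (n + 1) ≤
      2 * ∑ z ∈ cl (n + 1) x \ U, ρ z ^ 2 + (2 / ((b : ℝ) - 1)) * ∑ j ∈ J, (∑ z ∈ cl j (Y j), ρ z) ^ 2 / (b : ℝ) ^ j := by
    have hpow : 0 < (b : ℝ) ^ (n + 1) := pow_pos hbR0 _
    rw [div_le_iff₀ hpow, hS]
    have h2 : (∑ z ∈ cl (n + 1) x \ U, ρ z + ∑ j ∈ J, ∑ z ∈ cl j (Y j), ρ z) ^ 2 ≤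
        2 * (∑ z ∈ cl (n + 1) x \ U, ρ z) ^ 2 + 2 * (∑ j ∈ J, ∑ z ∈ cl j (Y j), ρ z) ^ 2 := by
      nlinarith [sq_nonneg (∑ z ∈ cl (n + 1) x \ U, ρ z - ∑ j ∈ J, ∑ z ∈ cl j (Y j), ρ z)]
    have hθ' : (2 / ((b : ℝ) - 1)) * (∑ j ∈ J, (∑ z ∈ cl j (Y j), ρ z) ^ 2 / (b : ℝ) ^ j) * (b : ℝ) ^ (n + 1) =
        2 * (((b : ℝ) ^ (n + 1) / ((b : ℝ) - 1)) * ∑ j ∈ J, (∑ z ∈ cl j (Y j), ρ z) ^ 2 / (b : ℝ) ^ j) := by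
      field_simp
    nlinarith [h2, hrest, hsed, hθ', hpow, hErest0]
  -- (8) regrouping the lower generations along the parent map
  have hregroup : ∑ j ∈ range (n + 1), (∑ z ∈ cl j (Y j), ρ z) ^ 2 / (b : ℝ) ^ j =
      ∑ j' ∈ J, ∑ j ∈ (range (n + 1)).filter (fun j => p j = j'), (∑ z ∈ cl j (Y j), ρ z) ^ 2 / (b : ℝ) ^ j :=
    (sum_fiberwise_of_maps_to hpJ _).symm
  -- (9) each fibre is dominated by `Q(f_{j'})`, which the hypothesis bounds
  have hfib : ∀ j' ∈ J, ∑ j ∈ (range (n + 1)).filter (fun j => p j = j'), (∑ z ∈ cl j (Y j), ρ z) ^ 2 / (b : ℝ) ^ j ≤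
      C * ∑ z ∈ cl j' (Y j'), ρ z ^ 2 - D * ((∑ z ∈ cl j' (Y j'), ρ z) ^ 2 / (b : ℝ) ^ j') := by
    intro j' hj'
    have hj'n : j' ≤ n := by have := mem_range.mp (hJsub hj'); omega
    have hfsub : (range (n + 1)).filter (fun j => p j = j') ⊆ range (j' + 1) := by
      intro j hj
      rw [mem_filter] at hj
      have := (hp_spec j hj.1).2.1
      rw [mem_range]; omega
    have h1 : ∑ j ∈ (range (n + 1)).filter (fun j => p j = j'), (∑ z ∈ cl j (Y j), ρ z) ^ 2 / (b : ℝ) ^ j ≤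
        ∑ j ∈ (range (n + 1)).filter (fun j => p j = j'),
          (cl j' (Y j')).sup' ⟨Y j', h_mem j' (Y j')⟩ (fun y' => (∑ z ∈ cl j y', ρ z) ^ 2 / (b : ℝ) ^ j) := by
      refine sum_le_sum fun j hj => ?_
      rw [mem_filter] at hj
      have hsub := (hp_spec j hj.1).2.2.1
      rw [hj.2] at hsub
      exact le_sup' (fun y' => (∑ z ∈ cl j y', ρ z) ^ 2 / (b : ℝ) ^ j) (hsub (h_mem j (Y j)))
    have h2 : ∑ j ∈ (range (n + 1)).filter (fun j => p j = j'),
          (cl j' (Y j')).sup' ⟨Y j', h_mem j' (Y j')⟩ (fun y' => (∑ z ∈ cl j y', ρ z) ^ 2 / (b : ℝ) ^ j) ≤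
        ∑ j ∈ range (j' + 1), (cl j' (Y j')).sup' ⟨Y j', h_mem j' (Y j')⟩ (fun y' => (∑ z ∈ cl j y', ρ z) ^ 2 / (b : ℝ) ^ j) :=
      sum_le_sum_of_subset_of_nonneg hfsub fun i _ _ =>
        (he0 i (Y j')).trans (le_sup' (fun y' => (∑ z ∈ cl i y', ρ z) ^ 2 / (b : ℝ) ^ i) (h_mem j' (Y j')))
    have h3 := ih j' hj'n (Y j')
    linarith
  have hsumF : ∑ j ∈ range (n + 1), (∑ z ∈ cl j (Y j), ρ z) ^ 2 / (b : ℝ) ^ j ≤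
      C * ∑ j' ∈ J, ∑ z ∈ cl j' (Y j'), ρ z ^ 2 - D * ∑ j' ∈ J, (∑ z ∈ cl j' (Y j'), ρ z) ^ 2 / (b : ℝ) ^ j' := by
    rw [hregroup, mul_sum, mul_sum, ← sum_sub_distrib]
    exact sum_le_sum fun j' hj' => hfib j' hj'
  -- (10) assemble: split off the top generation, then linear arithmetic
  rw [sum_range_succ, sup'_self_eq cl h_mem h_eq ρ (b : ℝ) (n + 1) x, sum_congr rfl fun j _ => hsup j, hEsum]
  have hkey : (1 + D) * ((∑ z ∈ cl (n + 1) x, ρ z) ^ 2 / (b : ℝ) ^ (n + 1)) ≤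
      (1 + D) * (2 * ∑ z ∈ cl (n + 1) x \ U, ρ z ^ 2 + (2 / ((b : ℝ) - 1)) * ∑ j ∈ J, (∑ z ∈ cl j (Y j), ρ z) ^ 2 / (b : ℝ) ^ j) :=
    mul_le_mul_of_nonneg_left hec (by linarith)
  nlinarith [hkey, hsumF, hconst1, hconst2, hErest0, hsumF0, hD0, hC0]

/-- ★★★ **THE STRENGTHENED INVARIANT** (px16 g22's road): for nested partitions with classes of size `≤ b^n` (`b ≥ 4`) and ANY real `ρ`, every class `cl n x` satisfies
    `Σ_{j ≤ n} max_{y ∈ cl n x} S_j(y)²∕b^j + (2∕(b−3))·S_n(x)²∕b^n ≤ (2(b−1)∕(b−3))·Σ_{z ∈ cl n x} ρ z²`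
(strong induction: `cellMax_base`, `cellMax_step`). [cite: Balaban1985Averaging, (19)-(20) p.21 (bookkeeping)] -/
theorem cellMax_invariant [DecidableEq X] (b : ℕ) (hb : 4 ≤ b) (cl : ℕ → X → Finset X) (h_mem : ∀ n x, x ∈ cl n x)
    (h_eq : ∀ n x y, y ∈ cl n x → cl n y = cl n x) (h_nest : ∀ n x, cl n x ⊆ cl (n + 1) x) (h_card : ∀ n x, (cl n x).card ≤ b ^ n)
    (ρ : X → ℝ) (n : ℕ) (x : X) :
    (∑ j ∈ range (n + 1), (cl n x).sup' ⟨x, h_mem n x⟩ (fun y' => (∑ z ∈ cl j y', ρ z) ^ 2 / (b : ℝ) ^ j)) +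
        (2 / ((b : ℝ) - 3)) * ((∑ z ∈ cl n x, ρ z) ^ 2 / (b : ℝ) ^ n) ≤
      (2 * ((b : ℝ) - 1) / ((b : ℝ) - 3)) * ∑ z ∈ cl n x, ρ z ^ 2 := by
  induction n using Nat.strong_induction_on generalizing x with
  | _ n ih =>
    cases n with
    | zero => exact cellMax_base b hb cl h_mem h_eq h_card ρ x
    | succ n => exact cellMax_step b hb cl h_mem h_eq h_nest h_card ρ n (fun k hk y => ih k (by omega) y) x

end Invariant

/-! ## §4 The cell-maximal square function bound -/

section Sum

variable [Fintype X]

/-- ★★★ **THE CELL-MAXIMAL SQUARE FUNCTION LEMMA, ONE TOP CLASS**: if `cl m x₀` is everything, then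
    `Σ_{n ≤ m} max_{y} S_n(y)²∕b^n ≤ (2(b−1)∕(b−3))·Σ_z ρ z²`
— the constant does not see `m` (K-uniformity of (SCT-c)'s curl-driven part, with `b = L^d`). [cite: Balaban1985Averaging, (19)-(20) p.21 (bookkeeping)] -/
theorem cellMax_sum_le [DecidableEq X] (b : ℕ) (hb : 4 ≤ b) (cl : ℕ → X → Finset X) (h_mem : ∀ n x, x ∈ cl n x)
    (h_eq : ∀ n x y, y ∈ cl n x → cl n y = cl n x) (h_nest : ∀ n x, cl n x ⊆ cl (n + 1) x) (h_card : ∀ n x, (cl n x).card ≤ b ^ n)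
    (ρ : X → ℝ) (m : ℕ) (x₀ : X) (h_top : ∀ y, y ∈ cl m x₀) :
    ∑ n ∈ range (m + 1), (univ : Finset X).sup' ⟨x₀, mem_univ x₀⟩ (fun y => (∑ z ∈ cl n y, ρ z) ^ 2 / (b : ℝ) ^ n) ≤
      (2 * ((b : ℝ) - 1) / ((b : ℝ) - 3)) * ∑ z, ρ z ^ 2 := by
  have hb' : (4 : ℝ) ≤ b := by exact_mod_cast hb
  have hinv := cellMax_invariant b hb cl h_mem h_eq h_nest h_card ρ m x₀
  have hcl : cl m x₀ = univ := eq_univ_of_forall h_top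
  have h1 : ∑ n ∈ range (m + 1), (univ : Finset X).sup' ⟨x₀, mem_univ x₀⟩ (fun y => (∑ z ∈ cl n y, ρ z) ^ 2 / (b : ℝ) ^ n) ≤
      ∑ j ∈ range (m + 1), (cl m x₀).sup' ⟨x₀, h_mem m x₀⟩ (fun y' => (∑ z ∈ cl j y', ρ z) ^ 2 / (b : ℝ) ^ j) :=
    sum_le_sum fun n _ => sup'_le _ _ fun y _ => le_sup' (fun y' => (∑ z ∈ cl n y', ρ z) ^ 2 / (b : ℝ) ^ n) (h_top y)
  have h2 : ∑ z ∈ cl m x₀, ρ z ^ 2 = ∑ z, ρ z ^ 2 := by rw [hcl]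
  have hD : 0 ≤ (2 / ((b : ℝ) - 3)) * ((∑ z ∈ cl m x₀, ρ z) ^ 2 / (b : ℝ) ^ m) := by
    apply mul_nonneg
    · apply div_nonneg <;> linarith
    · positivity
  rw [← h2]
  exact h1.trans (by linarith)

/-- ★★ **SEVERAL TOP CLASSES** (a read set covered by the gen-`m` classes of a family `R` of representatives): the per-generation maximum over ALL points is at most the sum over
`r ∈ R` of the maxima inside `cl m r`, so `Σ_{n ≤ m} max_y S_n(y)²∕b^n ≤ (2(b−1)∕(b−3))·Σ_{r∈R} Σ_{z ∈ cl m r} ρ z²` — and `≤ (2(b−1)∕(b−3))·Σ_z ρ z²` when the classes `cl m r`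
(`r ∈ R`) are pairwise disjoint. [cite: Balaban1985Averaging, (19)-(20) p.21 (bookkeeping)] -/
theorem cellMax_sum_le_of_cover [DecidableEq X] (b : ℕ) (hb : 4 ≤ b) (cl : ℕ → X → Finset X) (h_mem : ∀ n x, x ∈ cl n x)
    (h_eq : ∀ n x y, y ∈ cl n x → cl n y = cl n x) (h_nest : ∀ n x, cl n x ⊆ cl (n + 1) x) (h_card : ∀ n x, (cl n x).card ≤ b ^ n)
    (ρ : X → ℝ) (m : ℕ) (x₀ : X) (R : Finset X) (h_cover : ∀ y, ∃ r ∈ R, y ∈ cl m r)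
    (h_disj : (R : Set X).PairwiseDisjoint (fun r => cl m r)) :
    ∑ n ∈ range (m + 1), (univ : Finset X).sup' ⟨x₀, mem_univ x₀⟩ (fun y => (∑ z ∈ cl n y, ρ z) ^ 2 / (b : ℝ) ^ n) ≤
      (2 * ((b : ℝ) - 1) / ((b : ℝ) - 3)) * ∑ z, ρ z ^ 2 := by
  have hb' : (4 : ℝ) ≤ b := by exact_mod_cast hb
  have hC0 : 0 ≤ 2 * ((b : ℝ) - 1) / ((b : ℝ) - 3) := by apply div_nonneg <;> nlinarith
  have he0 : ∀ j y, 0 ≤ (∑ z ∈ cl j y, ρ z) ^ 2 / (b : ℝ) ^ j := fun j y => by positivity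
  -- the max over everything ≤ the sum over the cover of the maxima inside each top class
  have h1 : ∀ n, (univ : Finset X).sup' ⟨x₀, mem_univ x₀⟩ (fun y => (∑ z ∈ cl n y, ρ z) ^ 2 / (b : ℝ) ^ n) ≤
      ∑ r ∈ R, (cl m r).sup' ⟨r, h_mem m r⟩ (fun y => (∑ z ∈ cl n y, ρ z) ^ 2 / (b : ℝ) ^ n) := by
    intro n
    refine sup'_le _ _ fun y _ => ?_
    obtain ⟨r, hr, hyr⟩ := h_cover y
    calc (∑ z ∈ cl n y, ρ z) ^ 2 / (b : ℝ) ^ n ≤ (cl m r).sup' ⟨r, h_mem m r⟩ (fun y => (∑ z ∈ cl n y, ρ z) ^ 2 / (b : ℝ) ^ n) :=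
          le_sup' (fun y => (∑ z ∈ cl n y, ρ z) ^ 2 / (b : ℝ) ^ n) hyr
      _ ≤ ∑ r ∈ R, (cl m r).sup' ⟨r, h_mem m r⟩ (fun y => (∑ z ∈ cl n y, ρ z) ^ 2 / (b : ℝ) ^ n) :=
          single_le_sum (f := fun r => (cl m r).sup' ⟨r, h_mem m r⟩ (fun y => (∑ z ∈ cl n y, ρ z) ^ 2 / (b : ℝ) ^ n))
            (fun r' _ => (he0 n r').trans (le_sup' (fun y => (∑ z ∈ cl n y, ρ z) ^ 2 / (b : ℝ) ^ n) (h_mem m r'))) hr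
  -- sum over generations, swap, apply the invariant class by class
  have h2 : ∑ n ∈ range (m + 1), ∑ r ∈ R, (cl m r).sup' ⟨r, h_mem m r⟩ (fun y => (∑ z ∈ cl n y, ρ z) ^ 2 / (b : ℝ) ^ n) ≤
      ∑ r ∈ R, (2 * ((b : ℝ) - 1) / ((b : ℝ) - 3)) * ∑ z ∈ cl m r, ρ z ^ 2 := by
    rw [sum_comm]
    refine sum_le_sum fun r _ => ?_
    have hinv := cellMax_invariant b hb cl h_mem h_eq h_nest h_card ρ m r
    have hD : 0 ≤ (2 / ((b : ℝ) - 3)) * ((∑ z ∈ cl m r, ρ z) ^ 2 / (b : ℝ) ^ m) := by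
      apply mul_nonneg
      · apply div_nonneg <;> linarith
      · positivity
    linarith
  have h3 : ∑ r ∈ R, ∑ z ∈ cl m r, ρ z ^ 2 ≤ ∑ z, ρ z ^ 2 := by
    rw [← sum_biUnion h_disj]
    exact sum_le_sum_of_subset_of_nonneg (subset_univ _) fun z _ _ => sq_nonneg _
  calc ∑ n ∈ range (m + 1), (univ : Finset X).sup' ⟨x₀, mem_univ x₀⟩ (fun y => (∑ z ∈ cl n y, ρ z) ^ 2 / (b : ℝ) ^ n)
      ≤ ∑ n ∈ range (m + 1), ∑ r ∈ R, (cl m r).sup' ⟨r, h_mem m r⟩ (fun y => (∑ z ∈ cl n y, ρ z) ^ 2 / (b : ℝ) ^ n) :=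
        sum_le_sum fun n _ => h1 n
    _ ≤ ∑ r ∈ R, (2 * ((b : ℝ) - 1) / ((b : ℝ) - 3)) * ∑ z ∈ cl m r, ρ z ^ 2 := h2
    _ = (2 * ((b : ℝ) - 1) / ((b : ℝ) - 3)) * ∑ r ∈ R, ∑ z ∈ cl m r, ρ z ^ 2 := by rw [mul_sum]
    _ ≤ (2 * ((b : ℝ) - 1) / ((b : ℝ) - 3)) * ∑ z, ρ z ^ 2 := mul_le_mul_of_nonneg_left h3 hC0

end Sum


end Summit.QuantumFields.YangMills.Theorems.FluctuationComparisonRegPrIntLS2BetaCellMaximalSquareFunction
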